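import Summits.CriticalPhenomena.Ising3DConformalLimit.Theorems.PositivityBegetsConformalityExistsScaleCovariantLimitItemMaps
import Summits.CriticalPhenomena.Ising3DConformalLimit.Theorems.HyperoctahedralRPExistsScaleCovariantLimitSplitGlue
import Summits.CriticalPhenomena.Ising3DConformalLimit.Theorems.HyperoctahedralRPExistsScaleCovariantLimitFoldedCurrentEngineIffDoubling
import HarnessLib

/-!
# Split assembly for crux `ExistsScaleCovariantLimit` (item stmt-CriticalPhenomena-1981) at route `PositivityBegetsConformality`
# — and the sorry-free TWIN of the registered skeleton's composition (stub types `WallRepulsion`, `ClusterSetTotallyDisconnected`)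

Crux-strategist r1 (RESTATED re-exam, BC2 REDIRECT), 2026-08-17. The crux is, kernel-checked, EXACTLY item 6150
`MirrorHoelderCompactness.TwoPointDoubling` ∧ item 4659 `ClusterRigidity.ClusterSetTotallyDisconnected`
(`FoldedCurrentRepulsion.crux_iff_doubling_and_totallyDisconnected`, p139907). This file lands, under the canonical split-assembly
name of the crux protocol (`<RouteSlug><CruxDecl>Split.lean`, `…_of_subs`), the assembly `X₁ → X₂ → X` at the route's copy and —
NEW — the sorry-free twin of the composition `ExistsScaleCovariantLimit_of : WallRepulsion → ClusterSetTotallyDisconnected → X`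
of the REGISTERED skeleton `Lines/folded_current_repulsion.lean` (v9, lead c18), whose first stub is typed as the line's engine
`WallRepulsion` (⟺ item 6150, `wallRepulsion_iff_twoPointDoubling`, p138231) rather than as the item: so far that composition
existed only inside the sorry-bearing skeleton file, so no landed theorem had the type "registered stub signatures ⟹ crux".
Composition of landed theorems only; nothing is weakened, strengthened or defined.

References: H. Duminil-Copin, Proc. ICM 2022, §8.4 [DuminilCopinICM2022]; M. Aizenman, H. Duminil-Copin, Ann. of Math. 194 (2021),
arXiv:1912.07973, Remark 5.10 [AizenmanDuminilCopinAnnals2021]; M. Aizenman, arXiv:2509.02850, Thm 14.2 (folded current) [Aizenman2025].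
-/

namespace Summit.CriticalPhenomena.Ising3DConformalLimit.Cruxes.ExistsScaleCovariantLimit.PositivityBegetsConformalitySplit

open Summit.CriticalPhenomena.Ising3DConformalLimit.Theses
open Summit.CriticalPhenomena.Ising3DConformalLimit.Cruxes.ExistsScaleCovariantLimit

/-- **SPLIT ASSEMBLY at route `PositivityBegetsConformality`'s copy**: item 6150 ∧ item 4659 ⟹ the crux (p144658, re-exported
under the protocol name). [folklore] -/
theorem ExistsScaleCovariantLimit_of_subs : Summit.CriticalPhenomena.Ising3DConformalLimit.Theses.MirrorHoelderCompactness.TwoPointDoubling → Summit.CriticalPhenomena.Ising3DConformalLimit.Theses.ClusterRigidity.ClusterSetTotallyDisconnected → Summit.CriticalPhenomena.Ising3DConformalLimit.Theses.PositivityBegetsConformality.ExistsScaleCovariantLimit :=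
  PositivityBegetsConformalityMaps.crux_of_doubling_of_totallyDisconnected

/-- **EXACTNESS at the route's copy**: crux ⟺ item 6150 ∧ item 4659 (p144658). [folklore] -/
theorem ExistsScaleCovariantLimit_iff_subs : Summit.CriticalPhenomena.Ising3DConformalLimit.Theses.PositivityBegetsConformality.ExistsScaleCovariantLimit ↔ Summit.CriticalPhenomena.Ising3DConformalLimit.Theses.MirrorHoelderCompactness.TwoPointDoubling ∧ Summit.CriticalPhenomena.Ising3DConformalLimit.Theses.ClusterRigidity.ClusterSetTotallyDisconnected :=
  PositivityBegetsConformalityMaps.pbc_crux_iff_doubling_and_totallyDisconnected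

/-- **NECESSITY of both pieces** (refuter entry point at the route's copy). [folklore] -/
theorem subs_of_existsScaleCovariantLimit : Summit.CriticalPhenomena.Ising3DConformalLimit.Theses.PositivityBegetsConformality.ExistsScaleCovariantLimit → Summit.CriticalPhenomena.Ising3DConformalLimit.Theses.MirrorHoelderCompactness.TwoPointDoubling ∧ Summit.CriticalPhenomena.Ising3DConformalLimit.Theses.ClusterRigidity.ClusterSetTotallyDisconnected :=
  ExistsScaleCovariantLimit_iff_subs.1

/-- **SKELETON-COMPOSITION TWIN, route copy**: the registered stubs of line `folded-current-repulsion`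
(`stub_wallRepulsion : WallRepulsion`, `stub_clusterSetTotallyDisconnected : ClusterRigidity.ClusterSetTotallyDisconnected`)
imply the crux at route `PositivityBegetsConformality`'s copy — sorry-free (F2 ⟺ 6150 by `wallRepulsion_iff_twoPointDoubling`,
p138231; then p144658). [cite: arXiv:2509.02850, Thm 14.2] -/
theorem ExistsScaleCovariantLimit_of_stubs : Summit.CriticalPhenomena.Ising3DConformalLimit.Cruxes.ExistsScaleCovariantLimit.FoldedCurrentRepulsion.WallRepulsion → Summit.CriticalPhenomena.Ising3DConformalLimit.Theses.ClusterRigidity.ClusterSetTotallyDisconnected → Summit.CriticalPhenomena.Ising3DConformalLimit.Theses.PositivityBegetsConformality.ExistsScaleCovariantLimit :=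
  fun hW hT => ExistsScaleCovariantLimit_of_subs (FoldedCurrentRepulsion.wallRepulsion_iff_twoPointDoubling.1 hW) hT

/-- **SKELETON-COMPOSITION TWIN, registry copy** (`HyperoctahedralRP`, the `crux_decl` of the registered skeleton): the same
over the landed acyclic curried glue `SplitGlue.hrp_crux_of_doubling_of_totallyDisconnected` — the sorry-free twin of
`FoldedCurrentRepulsion.ExistsScaleCovariantLimit_of` of `Lines/folded_current_repulsion.lean`. [cite: arXiv:2509.02850, Thm 14.2] -/
theorem ExistsScaleCovariantLimit_of_stubs_hrp : Summit.CriticalPhenomena.Ising3DConformalLimit.Cruxes.ExistsScaleCovariantLimit.FoldedCurrentRepulsion.WallRepulsion → Summit.CriticalPhenomena.Ising3DConformalLimit.Theses.ClusterRigidity.ClusterSetTotallyDisconnected → Summit.CriticalPhenomena.Ising3DConformalLimit.Theses.HyperoctahedralRP.ExistsScaleCovariantLimit :=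
  fun hW hT => SplitGlue.hrp_crux_of_doubling_of_totallyDisconnected (FoldedCurrentRepulsion.wallRepulsion_iff_twoPointDoubling.1 hW) hT

end Summit.CriticalPhenomena.Ising3DConformalLimit.Cruxes.ExistsScaleCovariantLimit.PositivityBegetsConformalitySplit
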